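import Summits.Ventures.PercRepro2.CaseOnePocketConn
import Summits.Ventures.PercRepro2.CaseOnePairReal

/-!
# A pocket with two special vertices is a tree gadget: the measure side
(blind cell PercRepro2, p1 g27; the second pocket reduction of the case-1 rung)

For a pocket `(W, x, P)` and two vertices `z₁, z₂ ∈ W`, the outside sees the pocket only through the
pair of Boolean observables `(A, B) = ([z₁ ↔ x through P], [z₂ ↔ x through P])` (`pkConn`), which is
independent of the outside configuration. **Realisation**: a pair of Bernoulli variables with
`P(A ∧ B) ≥ P(A) P(B)` (Harris) is the law of `(r ∧ s, r ∧ t)` for three independent Bernoullis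
`r = P(A)P(B)/P(A∧B)`, `s = P(A∧B)/P(B)`, `t = P(A∧B)/P(A)` (`realR`, `realS`, `realT` of
`CaseOnePairReal`; the degenerate case `P(A ∧ B) = 0` has `P(A) P(B) = 0` and takes `r = 1, s = P(A),
t = P(B)`). So the pocket
is, for every observable of `(outside, A, B)`, the TREE GADGET `x –e₁– w –e₂– z₁`, `w –e₃– z₂` with the
weights `r, s, t` on `e₁, e₂, e₃` and `0` on the other edges of `P` (`pairW`): **`expect_pair`**. The
gadget's ends (`pairEnds`) and the graph-side correspondence are in `CaseOnePairPocketConn`. Own code;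
standard axioms. -/

namespace Summit.Ventures.PercRepro2

namespace CaseOne

section PairDefs
variable {V : Type*} {E : Type*} [DecidableEq E]

/-- `[z ↔ x through the edges of P]` as a Boolean observable of the configuration. -/
noncomputable def pkConn (ends : E → Sym2 V) (P : Finset E) (z x : V) (ω : Config E) : Bool :=
  @decide (Conn ends (inOnly P ω) z x) (Classical.dec _)

/-- `pkConn` reads the `P`-part of a merge. -/
lemma pkConn_merge (ends : E → Sym2 V) (P : Finset E) (z x : V) (ω₂ ω₁ : Config E) :
    pkConn ends P z x (merge P ω₂ ω₁) = pkConn ends P z x ω₂ := by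
  simp only [pkConn]
  exact decide_eq_decide.mpr (by rw [inOnly_merge])

/-- `pkConn` is the connection through `P`. -/
lemma pkConn_eq_true_iff (ends : E → Sym2 V) (P : Finset E) (z x : V) (ω : Config E) :
    pkConn ends P z x ω = true ↔ Conn ends (inOnly P ω) z x := by
  simp [pkConn]

/-- The ends of the tree gadget: `e₁ = {x, w}`, `e₂ = {w, z₁}`, `e₃ = {w, z₂}`, the other edges of `P`
loops at `x`, the edges off `P` unchanged. -/
def pairEnds (ends : E → Sym2 V) (P : Finset E) (e₁ e₂ e₃ : E) (x w z₁ z₂ : V) : E → Sym2 V :=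
  fun e => if e = e₁ then s(x, w) else if e = e₂ then s(w, z₁) else if e = e₃ then s(w, z₂)
    else if e ∈ P then s(x, x) else ends e

end PairDefs

/-! ## The tree gadget and the push-forward -/

section PairMeasure
variable {V : Type*} {E : Type*} [Fintype E] [DecidableEq E] {R : Type*} [Field R] [LinearOrder R]
variable (p : E → R) (ends : E → Sym2 V) (P : Finset E) (e₁ e₂ e₃ : E) (x z₁ z₂ : V)

/-- `P(z₁ ↔ x through P)`. -/
noncomputable def pairQ1 : R := prob (inW P p) {ω | pkConn ends P z₁ x ω = true}

/-- `P(z₂ ↔ x through P)`. -/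
noncomputable def pairQ2 : R := prob (inW P p) {ω | pkConn ends P z₂ x ω = true}

/-- `P(z₁ ↔ x ∧ z₂ ↔ x through P)`. -/
noncomputable def pairQ12 : R :=
  prob (inW P p) {ω | pkConn ends P z₁ x ω = true ∧ pkConn ends P z₂ x ω = true}

/-- The weights of the tree gadget: `r, s, t` on `e₁, e₂, e₃`, `0` on the other edges of `P`, `p`
elsewhere. -/
noncomputable def pairW : E → R :=
  fun e => if e = e₁ then realR (pairQ1 p ends P x z₁) (pairQ2 p ends P x z₂) (pairQ12 p ends P x z₁ z₂)
    else if e = e₂ then realS (pairQ1 p ends P x z₁) (pairQ2 p ends P x z₂) (pairQ12 p ends P x z₁ z₂)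
    else if e = e₃ then realT (pairQ1 p ends P x z₁) (pairQ2 p ends P x z₂) (pairQ12 p ends P x z₁ z₂)
    else if e ∈ P then 0 else p e

variable {e₁ e₂ e₃}

/-- Off `P` the gadget weights are the outside weights. -/
lemma outW_pairW (he₁ : e₁ ∈ P) (he₂ : e₂ ∈ P) (he₃ : e₃ ∈ P) :
    outW P (pairW p ends P e₁ e₂ e₃ x z₁ z₂) = outW P p := by
  funext e
  by_cases he : e ∈ P
  · simp [outW, he]
  · have h1 : e ≠ e₁ := fun h => he (h ▸ he₁)
    have h2 : e ≠ e₂ := fun h => he (h ▸ he₂)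
    have h3 : e ≠ e₃ := fun h => he (h ▸ he₃)
    simp [outW, pairW, he, h1, h2, h3]

/-- The gadget weight of the stem. -/
lemma pairW_e₁ : pairW p ends P e₁ e₂ e₃ x z₁ z₂ e₁ =
    realR (pairQ1 p ends P x z₁) (pairQ2 p ends P x z₂) (pairQ12 p ends P x z₁ z₂) := by
  simp [pairW]

/-- The gadget weight of the first branch. -/
lemma pairW_e₂ (h12 : e₁ ≠ e₂) : pairW p ends P e₁ e₂ e₃ x z₁ z₂ e₂ =
    realS (pairQ1 p ends P x z₁) (pairQ2 p ends P x z₂) (pairQ12 p ends P x z₁ z₂) := by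
  simp [pairW, h12.symm]

/-- The gadget weight of the second branch. -/
lemma pairW_e₃ (h13 : e₁ ≠ e₃) (h23 : e₂ ≠ e₃) : pairW p ends P e₁ e₂ e₃ x z₁ z₂ e₃ =
    realT (pairQ1 p ends P x z₁) (pairQ2 p ends P x z₂) (pairQ12 p ends P x z₁ z₂) := by
  simp [pairW, h13.symm, h23.symm]

/-- The `P`-weights of the gadget at `e₁`, `e₂`, `e₃`. -/
lemma inW_pairW_e₁ (he₁ : e₁ ∈ P) : inW P (pairW p ends P e₁ e₂ e₃ x z₁ z₂) e₁ =
    realR (pairQ1 p ends P x z₁) (pairQ2 p ends P x z₂) (pairQ12 p ends P x z₁ z₂) := by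
  simp [he₁, pairW_e₁]

/-- The `P`-weights of the gadget at `e₂`. -/
lemma inW_pairW_e₂ (he₂ : e₂ ∈ P) (h12 : e₁ ≠ e₂) : inW P (pairW p ends P e₁ e₂ e₃ x z₁ z₂) e₂ =
    realS (pairQ1 p ends P x z₁) (pairQ2 p ends P x z₂) (pairQ12 p ends P x z₁ z₂) := by
  simp [he₂, pairW_e₂ p ends P x z₁ z₂ h12]

/-- The `P`-weights of the gadget at `e₃`. -/
lemma inW_pairW_e₃ (he₃ : e₃ ∈ P) (h13 : e₁ ≠ e₃) (h23 : e₂ ≠ e₃) :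
    inW P (pairW p ends P e₁ e₂ e₃ x z₁ z₂) e₃ =
      realT (pairQ1 p ends P x z₁) (pairQ2 p ends P x z₂) (pairQ12 p ends P x z₁ z₂) := by
  simp [he₃, pairW_e₃ p ends P x z₁ z₂ h13 h23]

omit [Fintype E] in
/-- The merge reads `ω₂` on `P`. -/
lemma merge_of_mem {e : E} (he : e ∈ P) (ω₂ ω₁ : Config E) : merge P ω₂ ω₁ e = ω₂ e := by
  simp [merge, he]

omit [LinearOrder R] in
/-- The probability that two distinct edges are open is the product of their weights. -/
lemma prob_open_two (q : E → R) {e e' : E} (h : e ≠ e') :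
    prob q {ω | (ω e && ω e') = true} = q e * q e' := by
  have hset : {ω : Config E | (ω e && ω e') = true} = openEdge e' ∩ openEdge e := by
    ext ω
    simp [openEdge, Bool.and_eq_true, and_comm]
  rw [hset, prob_inter_openEdge, prob_openEdge, Function.update_of_ne h.symm]

omit [LinearOrder R] in
/-- The probability that three distinct edges are open is the product of their weights. -/
lemma prob_open_three (q : E → R) {e e' e'' : E} (h1 : e ≠ e') (h2 : e ≠ e'') (h3 : e' ≠ e'') :
    prob q {ω | (ω e && ω e') = true ∧ (ω e && ω e'') = true} = q e * (q e' * q e'') := by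
  have hset : {ω : Config E | (ω e && ω e') = true ∧ (ω e && ω e'') = true} =
      (openEdge e'' ∩ openEdge e') ∩ openEdge e := by
    ext ω
    simp only [Set.mem_setOf_eq, Set.mem_inter_iff, openEdge, Bool.and_eq_true]
    tauto
  rw [hset, prob_inter_openEdge, prob_inter_openEdge, prob_openEdge, Function.update_of_ne h3.symm,
    Function.update_of_ne h2.symm, Function.update_of_ne h1.symm]

end PairMeasure

/-! ## The push-forward: a pocket with two special vertices is the tree gadget -/

section PairMaster
variable {V : Type*} {E : Type*} [Fintype E] [DecidableEq E] {R : Type*} [Field R] [LinearOrder R]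
  [IsStrictOrderedRing R]
variable {p : E → R} (hp : IsProbVec p) (ends : E → Sym2 V) (P : Finset E) (x z₁ z₂ : V)

include hp

/-- `q₁₂ ≤ q₁`. -/
lemma pairQ12_le_pairQ1 : pairQ12 p ends P x z₁ z₂ ≤ pairQ1 p ends P x z₁ :=
  prob_mono (IsProbVec.inW P hp) fun _ h => h.1

/-- `q₁₂ ≤ q₂`. -/
lemma pairQ12_le_pairQ2 : pairQ12 p ends P x z₁ z₂ ≤ pairQ2 p ends P x z₂ :=
  prob_mono (IsProbVec.inW P hp) fun _ h => h.2

/-- `0 ≤ q₁₂`. -/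
lemma pairQ12_nonneg : 0 ≤ pairQ12 p ends P x z₁ z₂ := prob_nonneg (IsProbVec.inW P hp) _

/-- `0 ≤ q₁`. -/
lemma pairQ1_nonneg : 0 ≤ pairQ1 p ends P x z₁ := prob_nonneg (IsProbVec.inW P hp) _

/-- `0 ≤ q₂`. -/
lemma pairQ2_nonneg : 0 ≤ pairQ2 p ends P x z₂ := prob_nonneg (IsProbVec.inW P hp) _

/-- `q₁ ≤ 1`. -/
lemma pairQ1_le_one : pairQ1 p ends P x z₁ ≤ 1 := prob_le_one (IsProbVec.inW P hp) _

/-- `q₂ ≤ 1`. -/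
lemma pairQ2_le_one : pairQ2 p ends P x z₂ ≤ 1 := prob_le_one (IsProbVec.inW P hp) _

omit hp [Fintype E] in
/-- `inOnly` is monotone. -/
lemma monotone_inOnly : Monotone (inOnly P : Config E → Config E) := by
  intro ω ω' h e
  by_cases he : e ∈ P
  · simpa [he] using h e
  · simp [he]

omit hp [Fintype E] in
/-- The event `{z ↔ x through P}` is increasing. -/
lemma isUpperSet_pkConn (z : V) : IsUpperSet {ω : Config E | pkConn ends P z x ω = true} := by
  have : {ω : Config E | pkConn ends P z x ω = true} = inOnly P ⁻¹' connEvent ends z x := by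
    ext ω
    simp [pkConn_eq_true_iff, connEvent]
  rw [this]
  exact (isUpperSet_connEvent ends z x).preimage (monotone_inOnly P)

/-- **Harris**: `q₁ · q₂ ≤ q₁₂`. -/
lemma pairQ_harris : pairQ1 p ends P x z₁ * pairQ2 p ends P x z₂ ≤ pairQ12 p ends P x z₁ z₂ := by
  have h := prob_mul_prob_le_prob_inter (IsProbVec.inW P hp) (isUpperSet_pkConn ends P x z₁)
    (isUpperSet_pkConn ends P x z₂)
  have hset : {ω : Config E | pkConn ends P z₁ x ω = true} ∩ {ω | pkConn ends P z₂ x ω = true} =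
      {ω | pkConn ends P z₁ x ω = true ∧ pkConn ends P z₂ x ω = true} := by
    ext ω
    simp
  rw [hset] at h
  exact h

/-- The gadget weights of a probability vector form a probability vector. -/
lemma IsProbVec.pairW (e₁ e₂ e₃ : E) :
    IsProbVec (CaseOne.pairW p ends P e₁ e₂ e₃ x z₁ z₂) := by
  have hH := pairQ_harris hp ends P x z₁ z₂
  have h1 := pairQ12_le_pairQ1 hp ends P x z₁ z₂
  have h2 := pairQ12_le_pairQ2 hp ends P x z₁ z₂
  have h0 := pairQ12_nonneg hp ends P x z₁ z₂
  have hq1 := pairQ1_nonneg hp ends P x z₁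
  have hq2 := pairQ2_nonneg hp ends P x z₂
  have hq1' := pairQ1_le_one hp ends P x z₁
  have hq2' := pairQ2_le_one hp ends P x z₂
  refine ⟨fun e => ?_, fun e => ?_⟩
  · unfold CaseOne.pairW
    split_ifs
    · exact realR_nonneg h0 hq1 hq2
    · exact realS_nonneg h0 hq1 hq2
    · exact realT_nonneg h0 hq1 hq2
    · exact le_rfl
    · exact hp.nonneg e
  · unfold CaseOne.pairW
    split_ifs
    · exact realR_le_one h0 hH
    · exact realS_le_one h2 hq1' hq2
    · exact realT_le_one h1 hq1 hq2'
    · exact zero_le_one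
    · exact hp.le_one e

/-- **Push-forward onto the tree gadget**: an observable of the outside configuration and of the two
connections `z₁ ↔ x`, `z₂ ↔ x` through the pocket has the same expectation under the gadget weights,
where the two connections become `e₁ ∧ e₂` and `e₁ ∧ e₃`. -/
theorem expect_pair {e₁ e₂ e₃ : E} (he₁ : e₁ ∈ P) (he₂ : e₂ ∈ P) (he₃ : e₃ ∈ P) (h12 : e₁ ≠ e₂)
    (h13 : e₁ ≠ e₃) (h23 : e₂ ≠ e₃) (G : Config E → Bool → Bool → R) :
    expect p (fun ω => G (outOnly P ω) (pkConn ends P z₁ x ω) (pkConn ends P z₂ x ω)) =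
      expect (pairW p ends P e₁ e₂ e₃ x z₁ z₂)
        (fun ω => G (outOnly P ω) (ω e₁ && ω e₂) (ω e₁ && ω e₃)) := by
  set q₁ := pairQ1 p ends P x z₁ with hq₁
  set q₂ := pairQ2 p ends P x z₂ with hq₂
  set q₁₂ := pairQ12 p ends P x z₁ z₂ with hq₁₂
  have hL : expect p (fun ω => G (outOnly P ω) (pkConn ends P z₁ x ω) (pkConn ends P z₂ x ω)) =
      expect (outW P p) (fun ω₁ => G (outOnly P ω₁) true true * q₁₂ +
        G (outOnly P ω₁) true false * (q₁ - q₁₂) + G (outOnly P ω₁) false true * (q₂ - q₁₂) +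
        G (outOnly P ω₁) false false * (1 - q₁ - q₂ + q₁₂)) := by
    rw [expect_split P]
    congr 1
    funext ω₁
    simp only [outOnly_merge, pkConn_merge]
    exact expect_bool_split2 (inW P p) (pkConn ends P z₁ x) (pkConn ends P z₂ x)
      (fun a b => G (outOnly P ω₁) a b)
  have hR : expect (pairW p ends P e₁ e₂ e₃ x z₁ z₂)
      (fun ω => G (outOnly P ω) (ω e₁ && ω e₂) (ω e₁ && ω e₃)) =
      expect (outW P p) (fun ω₁ => G (outOnly P ω₁) true true *
          (realR q₁ q₂ q₁₂ * (realS q₁ q₂ q₁₂ * realT q₁ q₂ q₁₂)) +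
        G (outOnly P ω₁) true false * (realR q₁ q₂ q₁₂ * realS q₁ q₂ q₁₂ -
          realR q₁ q₂ q₁₂ * (realS q₁ q₂ q₁₂ * realT q₁ q₂ q₁₂)) +
        G (outOnly P ω₁) false true * (realR q₁ q₂ q₁₂ * realT q₁ q₂ q₁₂ -
          realR q₁ q₂ q₁₂ * (realS q₁ q₂ q₁₂ * realT q₁ q₂ q₁₂)) +
        G (outOnly P ω₁) false false * (1 - realR q₁ q₂ q₁₂ * realS q₁ q₂ q₁₂ -
          realR q₁ q₂ q₁₂ * realT q₁ q₂ q₁₂ +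
          realR q₁ q₂ q₁₂ * (realS q₁ q₂ q₁₂ * realT q₁ q₂ q₁₂))) := by
    rw [expect_split P, outW_pairW p ends P x z₁ z₂ he₁ he₂ he₃]
    congr 1
    funext ω₁
    simp only [outOnly_merge, merge_of_mem P he₁, merge_of_mem P he₂, merge_of_mem P he₃]
    rw [expect_bool_split2 (inW P (pairW p ends P e₁ e₂ e₃ x z₁ z₂)) (fun ω => ω e₁ && ω e₂)
      (fun ω => ω e₁ && ω e₃) (fun a b => G (outOnly P ω₁) a b)]
    rw [prob_open_three _ h12 h13 h23, prob_open_two _ h12, prob_open_two _ h13,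
      inW_pairW_e₁ p ends P x z₁ z₂ he₁, inW_pairW_e₂ p ends P x z₁ z₂ he₂ h12,
      inW_pairW_e₃ p ends P x z₁ z₂ he₃ h13 h23]
  have hH := pairQ_harris hp ends P x z₁ z₂
  have h1 := pairQ12_le_pairQ1 hp ends P x z₁ z₂
  have h2 := pairQ12_le_pairQ2 hp ends P x z₁ z₂
  have h0 := pairQ12_nonneg hp ends P x z₁ z₂
  have hq1 := pairQ1_nonneg hp ends P x z₁
  have hq2 := pairQ2_nonneg hp ends P x z₂
  rw [hL, hR, ← mul_assoc, realR_mul_realS_mul_realT h1 h2 h0 hH hq1 hq2, realR_mul_realS h2 h0,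
    realR_mul_realT h1 h0]

end PairMaster

end CaseOne

end Summit.Ventures.PercRepro2
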